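import Literature.NumberTheory.EllipticCurves.GaloisActionProofs
import Literature.NumberTheory.EllipticCurves.KummerMap
import HarnessLib

/-!
# Route `GenusKolyvaginAtTwo`, LINE 19 «regular_plus_descent» on crux L⁺_T `PowDvdShaCardAtTwoPosT`
# (stmt-BirchSwinnertonDyer-23379): `RegularEigenCyclic` — at a REGULAR involution `h` of `E[2^{n+1}]` the
# fixed part, the anti-fixed part and the coinvariants are cyclic of order `2^{n+1}` (the three cyclicities)

Seat `bsd-line-gk2-p3` g15 (cell `bsd-f1-sign2`), `--supports stmt-BirchSwinnertonDyer-23379` (helper; closes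
nothing). THEOREMS ONLY (no definition, no named fact, no `sorry`); BSD is not proved by any of this.

The pen's LINE 19 skeleton (`regular_plus_descent.lean`, pen bsd-idea-1 g10, in progress at the time of writing)
isolates as its "certifiable lever" the pure-algebra stub

  `RegularEigenCyclic := ∀ W (n) (h ∈ Γ_ℚ), h² = 1 on E[2^{n+1}] → (REGULAR: ∃ P, 2^n(P + hP) ≠ 0) →
     (LOSSLESS: fixed 2^k-torsion = norms of 2^k-torsion) →
     (∃ P of order 2^{n+1}, E^{h=1} = ℤ·P) ∧ (∃ P of order 2^{n+1}, E^{h=−1} = ℤ·P) ∧ (∃ P, E = ℤ·P + (h−1)E)`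

— the local groups `E(ℚ_ℓ)/2^M`, `H¹_s(ℚ_ℓ)`, `H¹_nr(ℚ_ℓ, E[2^M])` at a regular Kolyvagin prime `ℓ` (`Frob_ℓ = h`), McCallum's
Lemma 5.3 over `ℚ` on the `Δ > 0` habitat where complex conjugation is diagonal and useless. This file proves it
(def unfolded; a `Theorems` file cannot import `Cruxes`), and shows that the LOSSLESS clause is not needed:

* §1 algebra of a pair `(P, hP)` (re-proved route-independently after this lineage's Q1/Q5 files): a `2`-torsion
  point `T` moved by `h` is `𝔽₂`-independent from `hT`; Nakayama by hand lifts this to `ℤ/2^M`-independence of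
  `P, hP` when `2^{M-1}P = T`;
* §2 **regular ⟹ free**: if `2^n(P + hP) ≠ 0` then `T = 2^n P` is moved by `h`, so `(P, hP)` is `ℤ/2^{n+1}`-free, and
  by COUNTING (`#E[2^{n+1}] = 4^{n+1}`, `card_torsionPoints_eq_sq_holds`) it is a basis: `E[2^{n+1}] = ℤP ⊕ ℤhP`, i.e.
  `E[2^{n+1}]` is free of rank one over `(ℤ/2^{n+1})[h]`;
* §3 the three cyclicities from freeness: `E^{h=1} = ℤ(P + hP)`, `E^{h=−1} = ℤ(P − hP)` (both of order `2^{n+1}`),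
  `E = ℤP + (h − 1)E`; main theorem `regularEigenCyclic` (= the stub VERBATIM, lossless clause unused).

References: [GrossLMS1991] §3 (3.1)–(3.3); [McCallumLMS1991] Lemma 5.3; [SilvermanAEC2009] Cor. III.6.4(b).
-/

set_option autoImplicit false
set_option linter.dupNamespace false

noncomputable section

open scoped Classical

namespace Summit.BirchSwinnertonDyer.BirchSwinnertonDyer.Theorems.GenusExact.RegularPlusDescent

open WeierstrassCurve Field
open Literature.NumberTheory.EllipticCurves Literature.NumberTheory.GaloisRepresentations

/-! ## §1 Algebra of a pair `(P, hP)` -/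

section Algebra

variable {G A : Type*} [Group G] [AddCommGroup A] [DistribMulAction G A]

/-- `a • T = (a % 2) • T` when `2 • T = 0`. [folklore] -/
private theorem zsmul_eq_emod_two_zsmul' {T : A} (h2 : (2 : ℤ) • T = 0) (a : ℤ) : a • T = (a % 2) • T := by
  conv_lhs => rw [← Int.emod_add_mul_ediv a 2]
  rw [add_smul, mul_comm, mul_smul, h2, smul_zero, add_zero]

/-- `𝔽₂`-independence of `T` and `gT` for a `2`-torsion point `T` moved by `g`. [folklore] -/
private theorem two_dvd_of_pair {g : G} {T : A} (h2 : (2 : ℤ) • T = 0) (hT : g • T ≠ T) {a b : ℤ}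
    (hab : a • T + b • (g • T) = 0) : (2 : ℤ) ∣ a ∧ (2 : ℤ) ∣ b := by
  have hT0 : T ≠ 0 := fun h ↦ hT (by rw [h, smul_zero])
  have hgT0 : g • T ≠ 0 := fun h ↦ hT0 (by
    have h' := congrArg (fun x ↦ g⁻¹ • x) h
    simpa only [inv_smul_smul, smul_zero] using h')
  have h2g : (2 : ℤ) • (g • T) = 0 := by rw [smul_comm, h2, smul_zero]
  have hsum : T + g • T ≠ 0 := fun h ↦ hT (by
    have h' : g • T = -T := eq_neg_of_add_eq_zero_right h
    rw [h', neg_eq_iff_add_eq_zero, ← two_zsmul, h2])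
  rw [zsmul_eq_emod_two_zsmul' h2 a, zsmul_eq_emod_two_zsmul' h2g b] at hab
  rcases Int.emod_two_eq_zero_or_one a with ha | ha <;>
    rcases Int.emod_two_eq_zero_or_one b with hb | hb
  · exact ⟨Int.dvd_of_emod_eq_zero ha, Int.dvd_of_emod_eq_zero hb⟩
  · rw [ha, hb, zero_smul, one_smul, zero_add] at hab
    exact absurd hab hgT0
  · rw [ha, hb, one_smul, zero_smul, add_zero] at hab
    exact absurd hab hT0
  · rw [ha, hb, one_smul, one_smul] at hab
    exact absurd hab hsum

/-- Nakayama by hand: `2^M P = 0`, `2^{M-1} P = T` with `T` as above make `P, gP` independent over `ℤ/2^M`.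
[folklore] -/
private theorem pow_dvd_of_pair {g : G} {T : A} (h2 : (2 : ℤ) • T = 0) (hT : g • T ≠ T) :
    ∀ (M : ℕ) (P : A), (2 : ℤ) ^ M • P = 0 → (2 : ℤ) ^ (M - 1) • P = T →
      ∀ a b : ℤ, a • P + b • (g • P) = 0 → (2 : ℤ) ^ M ∣ a ∧ (2 : ℤ) ^ M ∣ b := by
  intro M
  induction M with
  | zero =>
    intro P _ _ a b _
    exact ⟨by simp, by simp⟩
  | succ M ih =>
    intro P hP hPT a b hab
    rw [Nat.add_sub_cancel] at hPT
    have habT : a • T + b • (g • T) = 0 := by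
      have h' := congrArg (fun x : A ↦ (2 : ℤ) ^ M • x) hab
      simp only [smul_add, smul_zero] at h'
      rwa [smul_comm ((2 : ℤ) ^ M) a P, smul_comm ((2 : ℤ) ^ M) b (g • P),
        smul_comm ((2 : ℤ) ^ M) g P, hPT] at h'
    obtain ⟨⟨a₁, rfl⟩, ⟨b₁, rfl⟩⟩ := two_dvd_of_pair h2 hT habT
    rcases Nat.eq_zero_or_pos M with hM | hM
    · subst hM
      exact ⟨by simp, by simp⟩
    · have hP2 : (2 : ℤ) ^ M • ((2 : ℤ) • P) = 0 := by rw [smul_smul, ← pow_succ, hP]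
      have hP2T : (2 : ℤ) ^ (M - 1) • ((2 : ℤ) • P) = T := by
        rw [smul_smul, ← pow_succ, Nat.sub_add_cancel hM, hPT]
      have hab₁ : a₁ • ((2 : ℤ) • P) + b₁ • (g • ((2 : ℤ) • P)) = 0 := by
        rw [← smul_comm (2 : ℤ) g P, smul_smul, smul_smul, mul_comm a₁ 2, mul_comm b₁ 2]
        exact hab
      obtain ⟨ha, hb⟩ := ih ((2 : ℤ) • P) hP2 hP2T a₁ b₁ hab₁
      exact ⟨by rw [pow_succ']; exact mul_dvd_mul_left 2 ha,
        by rw [pow_succ']; exact mul_dvd_mul_left 2 hb⟩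

/-- `a • R` only depends on `a mod 2^m` when `2^m • R = 0`. [folklore] -/
private theorem val_intCast_zsmul' {m : ℕ} [NeZero (2 ^ m)] (a : ℤ) (R : A)
    (hR : ((2 ^ m : ℕ) : ℤ) • R = 0) : (((a : ZMod (2 ^ m)).val : ℤ)) • R = a • R := by
  rw [ZMod.val_intCast]
  conv_rhs => rw [← Int.emod_add_mul_ediv a ((2 ^ m : ℕ) : ℤ), add_zsmul, mul_smul, smul_comm, hR, smul_zero,
    add_zero]

/-- **The three cyclicities of a free rank-one `(ℤ/2^m)[C₂]`-module.** For `g` acting as an involution and a FREE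
basis `(P, gP)` of `E[2^m]` over `ℤ/2^m` (generation `hgen` + independence `hfree`): the `g`-fixed part is
`ℤ(P + gP)`, the anti-fixed part is `ℤ(P − gP)`, both generators of order `2^m`, and `E[2^m] = ℤP + (g − 1)E[2^m]`.
[cite: McCallumLMS1991, Lemma 5.3] [cite: GrossLMS1991, §3 (3.1)–(3.3)] -/
theorem three_cyclicities_of_free (W : WeierstrassCurve ℚ) (m : ℕ) {g : absoluteGaloisGroup ℚ}
    (P : geomTorsion W ((2 ^ m : ℕ) : ℤ)) (hgg : g • (g • P) = P)
    (hgen : ∀ Q : geomTorsion W ((2 ^ m : ℕ) : ℤ), ∃ a b : ℤ, Q = a • P + b • (g • P))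
    (hfree : ∀ a b : ℤ, a • P + b • (g • P) = 0 → ((2 ^ m : ℕ) : ℤ) ∣ a ∧ ((2 ^ m : ℕ) : ℤ) ∣ b) :
    (addOrderOf (P + g • P) = 2 ^ m ∧
        ∀ Q : geomTorsion W ((2 ^ m : ℕ) : ℤ), g • Q = Q ↔ Q ∈ AddSubgroup.zmultiples (P + g • P)) ∧
      (addOrderOf (P - g • P) = 2 ^ m ∧
        ∀ Q : geomTorsion W ((2 ^ m : ℕ) : ℤ), g • Q = -Q ↔ Q ∈ AddSubgroup.zmultiples (P - g • P)) ∧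
      (∀ X : geomTorsion W ((2 ^ m : ℕ) : ℤ), ∃ (a : ℤ) (Y : geomTorsion W ((2 ^ m : ℕ) : ℤ)),
        X = a • P + (g • Y - Y)) := by
  have hPn : ((2 ^ m : ℕ) : ℤ) • P = 0 :=
    Subtype.ext ((mem_geomTorsion_iff W _ (P : geomPoints W)).mp P.2)
  have hgPn : ((2 ^ m : ℕ) : ℤ) • (g • P) = 0 := by rw [smul_comm, hPn, smul_zero]
  -- `g` on a combination
  have hgQ : ∀ a b : ℤ, g • (a • P + b • (g • P)) = b • P + a • (g • P) := fun a b ↦ by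
    rw [smul_add, smul_comm g a P, smul_comm g b (g • P), hgg, add_comm]
  -- orders of `P ± gP`
  have hordN : addOrderOf (P + g • P) = 2 ^ m := by
    refine Nat.dvd_antisymm (addOrderOf_dvd_of_nsmul_eq_zero ?_) ?_
    · rw [← natCast_zsmul, zsmul_add, hPn, hgPn, add_zero]
    · have h := addOrderOf_nsmul_eq_zero (P + g • P)
      rw [← natCast_zsmul, zsmul_add] at h
      exact_mod_cast (hfree _ _ h).1
  have hordD : addOrderOf (P - g • P) = 2 ^ m := by
    refine Nat.dvd_antisymm (addOrderOf_dvd_of_nsmul_eq_zero ?_) ?_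
    · rw [← natCast_zsmul, zsmul_sub, hPn, hgPn, sub_zero]
    · have h := addOrderOf_nsmul_eq_zero (P - g • P)
      rw [← natCast_zsmul, zsmul_sub, sub_eq_add_neg, ← neg_zsmul] at h
      exact_mod_cast (hfree _ _ h).1
  refine ⟨⟨hordN, fun Q ↦ ⟨fun hQ ↦ ?_, ?_⟩⟩, ⟨hordD, fun Q ↦ ⟨fun hQ ↦ ?_, ?_⟩⟩, fun X ↦ ?_⟩
  · -- fixed ⟹ multiple of the norm
    obtain ⟨a, b, hab⟩ := hgen Q
    have hdiff : (a - b) • P + (b - a) • (g • P) = 0 := by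
      have e : (a - b) • P + (b - a) • (g • P) = (a • P + b • (g • P)) - (b • P + a • (g • P)) := by
        simp only [sub_zsmul]; abel
      rw [e, ← hgQ a b, ← hab, hQ, sub_self]
    obtain ⟨⟨k, hk⟩, -⟩ := hfree _ _ hdiff
    refine (AddSubgroup.mem_zmultiples_iff).mpr ⟨b, ?_⟩
    have ha : a = b + ((2 ^ m : ℕ) : ℤ) * k := by linear_combination hk
    rw [hab, ha, add_zsmul, mul_comm, mul_zsmul, hPn, zsmul_zero, add_zero, zsmul_add]
  · rintro ⟨k, rfl⟩
    rw [smul_comm, smul_add, hgg, add_comm]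
  · -- anti-fixed ⟹ multiple of `P - gP`
    obtain ⟨a, b, hab⟩ := hgen Q
    have hsum : (a + b) • P + (a + b) • (g • P) = 0 := by
      have e : (a + b) • P + (a + b) • (g • P) = (a • P + b • (g • P)) + (b • P + a • (g • P)) := by
        simp only [add_zsmul]; abel
      rw [e, ← hgQ a b, ← hab, hQ, add_neg_cancel]
    obtain ⟨-, ⟨k, hk⟩⟩ := hfree _ _ hsum
    refine (AddSubgroup.mem_zmultiples_iff).mpr ⟨a, ?_⟩
    have hb : b = -a + ((2 ^ m : ℕ) : ℤ) * k := by linear_combination hk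
    rw [hab, hb, add_zsmul, mul_comm, mul_zsmul, hgPn, zsmul_zero, add_zero, zsmul_sub, neg_zsmul,
      sub_eq_add_neg]
  · rintro ⟨k, rfl⟩
    rw [smul_comm, smul_sub, hgg, ← zsmul_neg, neg_sub]
  · -- coinvariants
    obtain ⟨a, b, hab⟩ := hgen X
    refine ⟨a + b, b • P, ?_⟩
    rw [hab, add_zsmul, smul_comm g b P]
    abel

end Algebra

/-! ## §2 Regular ⟹ free, by counting -/

/-- **A regular involution makes `E[2^{n+1}]` free of rank one over `(ℤ/2^{n+1})[h]`.** If `h` acts on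
`E[2^{n+1}]` (as an involution or not) and `2^n(P + hP) ≠ 0` for some `P`, then `T = 2^n P` is a `2`-torsion point
moved by `h`, `(P, hP)` is `ℤ/2^{n+1}`-independent (Nakayama by hand), and since `#E[2^{n+1}] = 4^{n+1}` it is a
basis: every point is `aP + b·hP`. [cite: SilvermanAEC2009, Cor. III.6.4(b)] [cite: GrossLMS1991, §3 (3.3)] -/
theorem free_of_regular (W : WeierstrassCurve ℚ) [W.IsElliptic] (n : ℕ) {h : absoluteGaloisGroup ℚ}
    (P : geomTorsion W ((2 ^ (n + 1) : ℕ) : ℤ)) (hreg : (2 : ℤ) ^ n • (P + h • P) ≠ 0) :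
    (∀ a b : ℤ, a • P + b • (h • P) = 0 →
        ((2 ^ (n + 1) : ℕ) : ℤ) ∣ a ∧ ((2 ^ (n + 1) : ℕ) : ℤ) ∣ b) ∧
      ∀ Q : geomTorsion W ((2 ^ (n + 1) : ℕ) : ℤ), ∃ a b : ℤ, Q = a • P + b • (h • P) := by
  haveI : NeZero (2 ^ (n + 1)) := ⟨pow_ne_zero _ two_ne_zero⟩
  have h2M0 : ((2 ^ (n + 1) : ℕ) : ℤ) ≠ 0 := by exact_mod_cast pow_ne_zero (n + 1) two_ne_zero
  have hPn : ((2 ^ (n + 1) : ℕ) : ℤ) • P = 0 :=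
    Subtype.ext ((mem_geomTorsion_iff W _ (P : geomPoints W)).mp P.2)
  have hPn' : (2 : ℤ) ^ (n + 1) • P = 0 := by exact_mod_cast hPn
  have hhPn : ((2 ^ (n + 1) : ℕ) : ℤ) • (h • P) = 0 := by rw [smul_comm, hPn, smul_zero]
  -- the `2`-torsion point `T = 2^n P` is moved by `h`
  set T : geomTorsion W ((2 ^ (n + 1) : ℕ) : ℤ) := (2 : ℤ) ^ n • P with hT
  have h2T : (2 : ℤ) • T = 0 := by rw [hT, smul_smul, ← pow_succ', hPn']
  have hTmoved : h • T ≠ T := by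
    intro hfix
    apply hreg
    rw [smul_add, smul_comm, ← hT, hfix, ← two_zsmul, h2T]
  -- independence
  have hfree : ∀ a b : ℤ, a • P + b • (h • P) = 0 →
      ((2 ^ (n + 1) : ℕ) : ℤ) ∣ a ∧ ((2 ^ (n + 1) : ℕ) : ℤ) ∣ b := by
    intro a b hab
    have := pow_dvd_of_pair h2T hTmoved (n + 1) P hPn' (by rw [Nat.add_sub_cancel]) a b hab
    exact_mod_cast this
  refine ⟨hfree, ?_⟩
  -- generation by counting
  haveI hfin : Finite (geomTorsion W ((2 ^ (n + 1) : ℕ) : ℤ)) :=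
    finite_torsionPoints_holds W (AlgebraicClosure ℚ) h2M0
  have hcard : Nat.card (geomTorsion W ((2 ^ (n + 1) : ℕ) : ℤ)) = (2 ^ (n + 1)) ^ 2 :=
    card_torsionPoints_eq_sq_holds W (AlgebraicClosure ℚ) (n := 2 ^ (n + 1))
      (by exact_mod_cast pow_ne_zero (n + 1) (two_ne_zero (α := AlgebraicClosure ℚ)))
  letI : Fintype (geomTorsion W ((2 ^ (n + 1) : ℕ) : ℤ)) := Fintype.ofFinite _
  let f : ZMod (2 ^ (n + 1)) × ZMod (2 ^ (n + 1)) → geomTorsion W ((2 ^ (n + 1) : ℕ) : ℤ) :=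
    fun x ↦ ((x.1.val : ℤ)) • P + ((x.2.val : ℤ)) • (h • P)
  have hf : ∀ a b : ℤ, f ((a : ZMod (2 ^ (n + 1))), (b : ZMod (2 ^ (n + 1)))) = a • P + b • (h • P) :=
    fun a b ↦ by
    simp only [f]
    rw [val_intCast_zsmul' a P hPn, val_intCast_zsmul' b (h • P) hhPn]
  have hinj : Function.Injective f := by
    rintro ⟨x₁, y₁⟩ ⟨x₂, y₂⟩ hxy
    simp only [f] at hxy
    have hdiff : ((x₁.val : ℤ) - (x₂.val : ℤ)) • P + ((y₁.val : ℤ) - (y₂.val : ℤ)) • (h • P) = 0 := by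
      rw [sub_zsmul, sub_zsmul]
      calc (x₁.val : ℤ) • P - (x₂.val : ℤ) • P + ((y₁.val : ℤ) • (h • P) - (y₂.val : ℤ) • (h • P))
          = ((x₁.val : ℤ) • P + (y₁.val : ℤ) • (h • P)) - ((x₂.val : ℤ) • P + (y₂.val : ℤ) • (h • P)) := by
            abel
        _ = 0 := by rw [hxy, sub_self]
    obtain ⟨ha, hb⟩ := hfree _ _ hdiff
    have key : ∀ {u v : ZMod (2 ^ (n + 1))}, ((2 ^ (n + 1) : ℕ) : ℤ) ∣ (u.val : ℤ) - (v.val : ℤ) → u = v := by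
      intro u v huv
      have e := (ZMod.intCast_eq_intCast_iff_dvd_sub (v.val : ℤ) (u.val : ℤ) (2 ^ (n + 1))).mpr huv
      rw [Int.cast_natCast, Int.cast_natCast, ZMod.natCast_zmod_val, ZMod.natCast_zmod_val] at e
      exact e.symm
    rw [Prod.mk.injEq]
    exact ⟨key ha, key hb⟩
  have hbij : Function.Bijective f := (Fintype.bijective_iff_injective_and_card f).mpr ⟨hinj, by
    rw [Fintype.card_prod, ZMod.card, ← Nat.card_eq_fintype_card, hcard, sq]⟩
  intro Q
  obtain ⟨⟨x, y⟩, hxy⟩ := hbij.2 Q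
  exact ⟨(x.val : ℤ), (y.val : ℤ), hxy.symm⟩

/-! ## §3 The stub -/

/-- **LINE 19 stub `RegularEigenCyclic` (L⁺_T 23379), VERBATIM with the skeleton-local def unfolded; the LOSSLESS
clause is not used.** For an involution `h` on `E[2^{n+1}]` that is REGULAR (`2^n(P + hP) ≠ 0` for some `P`): the
`h`-fixed part and the `h`-anti-fixed part are cyclic of order `2^{n+1}` (generated by `P + hP`, `P − hP`), and the
`h`-coinvariants are cyclic (generated by `P`) — the local groups `E(ℚ_ℓ)/2^M`, `H¹_s`, `H¹_nr` at a regular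
Kolyvagin prime. [cite: McCallumLMS1991, Lemma 5.3] [cite: GrossLMS1991, §3 (3.1)–(3.3)] -/
theorem regularEigenCyclic :
    ∀ (W : WeierstrassCurve ℚ) [W.IsElliptic] (n : ℕ) (h : Field.absoluteGaloisGroup ℚ),
      (∀ X : W.geomTorsion ((2 ^ (n + 1) : ℕ) : ℤ), h • h • X = X) →
      (∃ P : W.geomTorsion ((2 ^ (n + 1) : ℕ) : ℤ), (2 : ℤ) ^ n • (P + h • P) ≠ 0) →
      (∀ (k : ℕ) (X : W.geomTorsion ((2 ^ (n + 1) : ℕ) : ℤ)), (2 : ℤ) ^ k • X = 0 → h • X = X →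
        ∃ Y : W.geomTorsion ((2 ^ (n + 1) : ℕ) : ℤ), (2 : ℤ) ^ k • Y = 0 ∧ X = Y + h • Y) →
      (∃ P : W.geomTorsion ((2 ^ (n + 1) : ℕ) : ℤ), addOrderOf P = 2 ^ (n + 1) ∧
          ∀ Q : W.geomTorsion ((2 ^ (n + 1) : ℕ) : ℤ), h • Q = Q ↔ Q ∈ AddSubgroup.zmultiples P) ∧
        (∃ P : W.geomTorsion ((2 ^ (n + 1) : ℕ) : ℤ), addOrderOf P = 2 ^ (n + 1) ∧
          ∀ Q : W.geomTorsion ((2 ^ (n + 1) : ℕ) : ℤ), h • Q = -Q ↔ Q ∈ AddSubgroup.zmultiples P) ∧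
        (∃ P : W.geomTorsion ((2 ^ (n + 1) : ℕ) : ℤ), ∀ X : W.geomTorsion ((2 ^ (n + 1) : ℕ) : ℤ),
          ∃ (a : ℤ) (Y : W.geomTorsion ((2 ^ (n + 1) : ℕ) : ℤ)), X = a • P + (h • Y - Y)) := by
  intro W _ n h hinv hreg _
  obtain ⟨P, hP⟩ := hreg
  obtain ⟨hfree, hgen⟩ := free_of_regular W n P hP
  obtain ⟨h1, h2, h3⟩ := three_cyclicities_of_free W (n + 1) P (hinv P) hgen hfree
  exact ⟨⟨P + h • P, h1⟩, ⟨P - h • P, h2⟩, ⟨P, h3⟩⟩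

/-! ## §4 Regular ⟹ lossless (appended, seat gk2-p3 g15) -/

/-- **REGULAR ⟹ LOSSLESS.** For an involution `h` on `E[2^{n+1}]` with `2^n(P + hP) ≠ 0` for some `P`, every
`h`-fixed point `X` killed by `2^k` is the norm `Y + hY` of some `Y` killed by `2^k` (take `Y = tP` for `X = t(P + hP)`):
the clause «lossless» carried by the pen's `RegularKolyvaginSupplyAtTwo` / `RegularEigenCyclic` is automatic at a
regular prime. [cite: GrossLMS1991, §3 (3.3)] [cite: McCallumLMS1991, Lemma 5.3] -/
theorem lossless_of_regular (W : WeierstrassCurve ℚ) [W.IsElliptic] (n : ℕ) {h : absoluteGaloisGroup ℚ}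
    (hinv : ∀ X : geomTorsion W ((2 ^ (n + 1) : ℕ) : ℤ), h • h • X = X)
    (hreg : ∃ P : geomTorsion W ((2 ^ (n + 1) : ℕ) : ℤ), (2 : ℤ) ^ n • (P + h • P) ≠ 0) :
    ∀ (k : ℕ) (X : geomTorsion W ((2 ^ (n + 1) : ℕ) : ℤ)), (2 : ℤ) ^ k • X = 0 → h • X = X →
      ∃ Y : geomTorsion W ((2 ^ (n + 1) : ℕ) : ℤ), (2 : ℤ) ^ k • Y = 0 ∧ X = Y + h • Y := by
  obtain ⟨P, hP⟩ := hreg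
  obtain ⟨hfree, hgen⟩ := free_of_regular W n P hP
  obtain ⟨⟨-, hfix⟩, -, -⟩ := three_cyclicities_of_free W (n + 1) P (hinv P) hgen hfree
  intro k X hkX hX
  obtain ⟨t, rfl⟩ := (AddSubgroup.mem_zmultiples_iff).mp ((hfix X).mp hX)
  refine ⟨t • P, ?_, by rw [smul_comm h t P, ← zsmul_add]⟩
  -- `2^k · t(P + hP) = 0` gives `2^{n+1} ∣ 2^k t`, hence `(2^k t) P = 0`
  have h0 : ((2 : ℤ) ^ k * t) • P + ((2 : ℤ) ^ k * t) • (h • P) = 0 := by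
    rw [← zsmul_add, mul_zsmul, hkX]
  obtain ⟨⟨c, hc⟩, -⟩ := hfree _ _ h0
  have hPn : ((2 ^ (n + 1) : ℕ) : ℤ) • P = 0 :=
    Subtype.ext ((mem_geomTorsion_iff W _ (P : geomPoints W)).mp P.2)
  rw [smul_smul, hc, mul_comm, mul_zsmul, hPn, zsmul_zero]

end Summit.BirchSwinnertonDyer.BirchSwinnertonDyer.Theorems.GenusExact.RegularPlusDescent

end
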